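import Summits.CriticalPhenomena.PercolationContinuityZ3.Theorems.PercNearOneGluingNoHeavyLowerTailSahiCombMeetAbsorbing

/-!
# The comb (tensor-Bernstein) hierarchy for Sahi's `E_k`, VI: hierarchy lifting at the comb level — `(k+1)`-wise meet absorption
# reduces comb positivity of EVERY order to the sub-families of size `≤ k` (the comb form of the hard-core reduction)

Support file of the one-cut programme (crux `NoHeavyLowerTail`, stmt-CriticalPhenomena-4575; cell `prim-masterthm`, seat P3; HIERARCHY.md §9).
Law-level originals: prim-l12-p5's THEOREM G (hierarchy lifting: `C_k` for the weight + "among any `k+1` slots one contains the meet of the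
others" ⇒ all orders) and THEOREM H (hard-core reduction), `…SahiHereditaryMeetAbsorption` / `…SahiHardCoreReduction`.  Comb level, product
measures, every `n`:

* `CardwiseMeetAbsorbing k U` — every sub-family of `k + 1` members (along an injection) has a member containing the intersection of the
  other `k`;
* **`combPos_sahiE_ind_of_cardwise`** — if `U` is `(k+1)`-wise meet-absorbing and every sub-family with `j ≤ k` members has `E_j`
  comb-positive at multidegree `j`, then `E_n(U)` is comb-positive at multidegree `n` (all `n`; strong induction through the local
  total-meet rung of `…SahiCombMeetAbsorbing`);
* `combPos_sahiE_ind_of_fourwise` — the case `k = 3`: FOURWISE meet absorption + comb positivity of the sub-TRIPLES (the `E_3` hard core,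
  e.g. by `combPos_sahiE_three_of_not_residual` when every sub-triple is off the residual class) ⇒ comb positivity at every order.
So, at the comb level exactly as at the law level, everything above order 3 on fourwise-absorbing families is carried by the triples.
HONEST FRAMING: nothing here asserts (M⁺-k) or `C_k` for `k ≥ 3`. [this work]
-/

noncomputable section

open scoped Classical

namespace Summit.CriticalPhenomena.PercolationContinuityZ3.Theorems

open Finset Function
open Literature.Combinatorics.Sahi2008
open Literature.Probability.Percolation.DecisionTree (ind ind_of_mem ind_of_not_mem ind_nonneg)
open SahiComb

variable {ι : Type} [Fintype ι]

omit [Fintype ι] in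
/-- **`(k+1)`-wise meet absorption**: in every sub-family of `k + 1` members (along an injection `e`) some member `e a` contains the
intersection of the other `k` (prim-l12-p5's hypothesis of hierarchy lifting; `k = 2` is `TriplewiseMeetAbsorbing`). [this work] -/
def CardwiseMeetAbsorbing (k : ℕ) {n : ℕ} (U : Fin n → Set (Set ι)) : Prop :=
  ∀ e : Fin (k + 1) ↪ Fin n, ∃ a : Fin (k + 1), (⋂ b : Fin k, U (e (a.succAbove b))) ⊆ U (e a)

omit [Fintype ι] in
/-- Sub-families along injections inherit `(k+1)`-wise meet absorption. [this work] -/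
theorem CardwiseMeetAbsorbing.comp_embedding {k n j : ℕ} {U : Fin n → Set (Set ι)} (h : CardwiseMeetAbsorbing k U)
    (e : Fin j ↪ Fin n) : CardwiseMeetAbsorbing k (fun l => U (e l)) :=
  fun e' => h (e'.trans e)

omit [Fintype ι] in
/-- A `(k+1)`-wise meet-absorbing family with at least `k + 1` members has a member containing the intersection of ALL the others.
[this work] -/
theorem CardwiseMeetAbsorbing.exists_totalMeet {k k' : ℕ} {U : Fin (k' + 3) → Set (Set ι)} (h : CardwiseMeetAbsorbing k U)
    (hk : k + 1 ≤ k' + 3) : ∃ m : Fin (k' + 3), (⋂ j, U (m.succAbove j)) ⊆ U m := by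
  obtain ⟨a, ha⟩ := h (Fin.castLEEmb hk)
  refine ⟨Fin.castLEEmb hk a, Set.Subset.trans (fun ω hω => Set.mem_iInter.2 fun b => ?_) ha⟩
  have hne : Fin.castLEEmb hk (a.succAbove b) ≠ Fin.castLEEmb hk a :=
    fun h' => Fin.succAbove_ne a b ((Fin.castLEEmb hk).injective h')
  obtain ⟨j, hj⟩ := Fin.exists_succAbove_eq hne
  have := Set.mem_iInter.1 hω j
  rwa [hj] at this

/-- **Hierarchy lifting at the comb level (every `n`).**  If `U` is `(k+1)`-wise meet-absorbing and every sub-family with `j ≤ k` members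
has `E_j` comb-positive at multidegree `j`, then `E_n(μ_p; 1_U)` is comb-positive at multidegree `n`. [this work] -/
theorem combPos_sahiE_ind_of_cardwise (k : ℕ) :
    ∀ (n : ℕ) (U : Fin n → Set (Set ι)), (∀ j, IsUpperSet (U j)) → CardwiseMeetAbsorbing k U →
      (∀ (j : ℕ) (e : Fin j ↪ Fin n), j ≤ k →
        CombPos (fun _ : ι => j) (fun p => sahiE (bernoulliWeight p) j (fun l => ind (U (e l))))) →
      CombPos (fun _ : ι => n) (fun p => sahiE (bernoulliWeight p) n (fun j => ind (U j))) := by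
  intro n
  induction n using Nat.strong_induction_on with
  | _ n ih =>
    intro U hU habs hcore
    by_cases hn : n ≤ k
    · -- the family itself is a sub-family of size `≤ k`
      exact (hcore n (Function.Embedding.refl _) hn).congr fun p => rfl
    · rcases Nat.lt_or_ge n 3 with hn3 | hn3
      · exact masterFamilyCombPos_of_le_two (by omega) ι U hU
      · obtain ⟨k', rfl⟩ : ∃ k', n = k' + 3 := ⟨n - 3, by omega⟩
        obtain ⟨m, hmeet⟩ := habs.exists_totalMeet (by omega)
        exact combPos_sahiE_ind_of_totalMeet_local U m hmeet fun j e hj =>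
          ih j (by omega) (fun l => U (e l)) (fun l => hU _) (habs.comp_embedding e)
            fun j' e' hj' => hcore j' (e'.trans e) hj'

/-- **The comb hard-core reduction (`k = 3`): fourwise meet absorption + comb-positive sub-triples ⇒ comb positivity at EVERY order.**
For `n` increasing events such that among any four one contains the intersection of the other three, and such that every sub-triple has
`E_3` comb-positive at multidegree `3` (e.g. off the residual class, `combPos_sahiE_three_of_not_residual`), `E_n` is comb-positive at
multidegree `n`. [this work] -/
theorem combPos_sahiE_ind_of_fourwise {n : ℕ} (U : Fin n → Set (Set ι)) (hU : ∀ j, IsUpperSet (U j))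
    (habs : CardwiseMeetAbsorbing 3 U)
    (h3 : ∀ e : Fin 3 ↪ Fin n, CombPos (fun _ : ι => 3) (fun p => sahiE (bernoulliWeight p) 3 (fun l => ind (U (e l))))) :
    CombPos (fun _ : ι => n) (fun p => sahiE (bernoulliWeight p) n (fun j => ind (U j))) := by
  refine combPos_sahiE_ind_of_cardwise 3 n U hU habs fun j e hj => ?_
  rcases Nat.lt_or_ge j 3 with hj3 | hj3
  · exact masterFamilyCombPos_of_le_two (by omega) ι _ fun l => hU _
  · obtain rfl : j = 3 := le_antisymm hj hj3
    exact h3 e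

/-- Law-level shadow of the comb hard-core reduction: `E_n(μ_p; 1_U) ≥ 0` under the hypotheses of `combPos_sahiE_ind_of_fourwise`.
[this work] -/
theorem sahiE_ind_nonneg_of_fourwise {n : ℕ} (p : ι → unitInterval) (U : Fin n → Set (Set ι)) (hU : ∀ j, IsUpperSet (U j))
    (habs : CardwiseMeetAbsorbing 3 U)
    (h3 : ∀ e : Fin 3 ↪ Fin n, CombPos (fun _ : ι => 3) (fun p => sahiE (bernoulliWeight p) 3 (fun l => ind (U (e l))))) :
    0 ≤ sahiE (bernoulliWeight p) n (fun j => ind (U j)) :=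
  (combPos_sahiE_ind_of_fourwise U hU habs h3).nonneg p

omit [Fintype ι] in
/-- Triplewise meet absorption is `(2+1)`-wise meet absorption. [this work] -/
theorem cardwiseMeetAbsorbing_two_of_triplewise {n : ℕ} {U : Fin n → Set (Set ι)} (h : TriplewiseMeetAbsorbing U) :
    CardwiseMeetAbsorbing 2 U := by
  intro e
  obtain ⟨m, hm⟩ := (h.comp_embedding e).exists_totalMeet (k := 0)
  exact ⟨m, hm⟩

end Summit.CriticalPhenomena.PercolationContinuityZ3.Theorems
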